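import Literature.Analysis.FluidPDE.BBGKYMarginalsProofs
import HarnessLib

/-!
# Proofs for `Literature.Analysis.FluidPDE.BBGKYMarginals`: the grand-canonical partition function
(trunk: FluidKinetic / T-KINETIC, item K3; a second companion ("Proofs") file of
`Literature.Analysis.FluidPDE.BBGKYMarginals`, next to `BBGKYMarginalsProofs.lean` (imported, for
`canonicalPartition_nonneg`) and `BBGKYMarginalsCorrelationProofs.lean`; kept separate because the
shared `BBGKYMarginalsProofs.lean` is extended concurrently by whole-file resubmissions.)

Contents:

1. `Literature.Analysis.FluidPDE.lintegral_prod_pi_le` — the hypothesis-free half of Fubini for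
   finite product measures: `∫⁻ ∏ᵢ gᵢ(zᵢ) ∂(Measure.pi μ) ≤ ∏ᵢ ∫⁻ gᵢ ∂μᵢ` for measurable
   `gᵢ ≥ 0` and *arbitrary* (not necessarily σ-finite) measures `μᵢ` (§1; helpers
   `measure_pi_univ_pi_le`, `finsetProd_iSup_of_monotone`, `prod_simpleFunc_apply_eq_sum`,
   `lintegral_prod_simpleFunc_pi_le`), and its Bochner-integral corollary
   `integral_le_pow_of_le_prod`: `∫ F ≤ (∫ f)^N` whenever `0 ≤ F ≤ f^{⊗N}` with `0 ≤ f ∈ L¹`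
   (helper `exists_measurable_ge_lintegral_eq`).
2. `Literature.Analysis.FluidPDE.gcPartition_pos_holds` and
   `Literature.Analysis.FluidPDE.gcPartition_le_exp_holds` — discharges of the named facts
   `Literature.Analysis.FluidPDE.gcPartition_pos` and `Literature.Analysis.FluidPDE.gcPartition_le_exp`
   with *exactly their parameters* (an arbitrary `[MeasureSpace X]`): the grand-canonical
   partition function `𝒵^ε = ∑_N (μ^N / N!) 𝒵_N` is positive and at most `exp (μ ∫ f₀)` for
   `0 ≤ μ`, `0 ≤ f₀ ∈ L¹` (§2; helpers `canonicalPartition_le_pow_integral`,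
   `canonicalPartition_zero_eq_one`, `gcPartition_term_le`, `summable_gcPartition_term`).

## Sources, and what is (not) printed

Gallagher–Saint-Raymond–Texier 2013 §6.1 ("Quasi-independence"; §6.1.2 "Conditioning", held as
`lit paper:arxiv-1208.5753`, chunk p0032) introduce the canonical partition functions
`𝒵_N := ∫ 1_{Z_N ∈ 𝒟_N} f_0^{⊗N}(Z_N) dZ_N` ((6.1.4) in the numbering used by
`BBGKYMarginals.lean`) of the conditioned data `𝒵_N⁻¹ 1_{Z_N ∈ 𝒟_N} f_0^{⊗N}` and use `𝒵_N⁻¹`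
freely (their Lemma 6.1.2, `1 ≤ 𝒵_N⁻¹ 𝒵_{N-s} ≤ (1 - ε κ_d |f_0|_{L^∞ L^1})^{-s}`, presupposes
`𝒵_N > 0`); Bodineau–Gallagher–Saint-Raymond–Simonella 2023 §1.1 replace the canonical by the
grand-canonical Gibbs-type state with `N`-particle weights `(𝒵^ε)⁻¹ (μ_ε^N / N!) 1_{𝒟^ε_N}`
times a tensorised one-particle density, normalised by the grand-canonical partition function
`𝒵^ε = ∑_N (μ_ε^N / N!) 𝒵_N` ((1.5) of arXiv:2012.03813; (1.1.5) in the numbering used by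
`BBGKYMarginals.lean`). Neither source prints `𝒵^ε > 0` or `𝒵^ε ≤ exp (μ ∫ f₀)` as a numbered
statement: they are the elementary remarks making `(𝒵^ε)⁻¹` meaningful (`1_{D_ε^N} ≤ 1`, so
`𝒵_N ≤ (∫ f₀)^N`, `= 1` for the normalised `f₀` of the sources; `𝒵_0 = 1`), recorded in
`BBGKYMarginals.lean` as the named facts `gcPartition_pos`, `gcPartition_le_exp` with the proof
sketch "the `N = 0` term is `1` and the series converges, being dominated by
`∑ μ^N (∫ f₀)^N / N! = exp (μ ∫ f₀)`". That sketch is formalised verbatim in §2: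
`canonicalPartition_le_pow_integral` (`𝒵_N ≤ (∫ f₀)^N`), `canonicalPartition_zero_eq_one`
(`𝒵_0 = 1`), `gcPartition_term_le` and `summable_gcPartition_term` (comparison with the
exponential series, `Real.summable_pow_div_factorial`), whence `gcPartition_pos_holds`
(`Summable.tsum_pos` at the index `N = 0`) and `gcPartition_le_exp_holds` (`Summable.tsum_le_tsum`
and `Real.exp x = ∑_N x^N / N!`, `NormedSpace.exp_eq_tsum_div`).

## No σ-finiteness

Both facts bind only `[MeasureSpace X]`: the `variable [SigmaFinite (volume : Measure X)]` in
force where they are stated in `BBGKYMarginals.lean` is not used by the bodies of the `def`s and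
hence is *not* one of their arguments (see the paragraph "Fubini for marginals, and the
σ-finiteness artifact of the named facts" of that file). Unlike `marginal_marginal` (a Fubini
*equality*, false-or-unprovable for a general position space), these two facts are *true* as
stated, and are discharged here without any hypothesis on `volume`: the bound `𝒵_N ≤ (∫ f₀)^N`
is not taken from the Fubini equality `MeasureTheory.integral_fintype_prod_volume_eq_pow`
(σ-finite factors) but from the half of Fubini for `Measure.pi` that holds for *arbitrary*
factors (§1), `lintegral_prod_pi_le`. Indeed `Measure.pi μ` is the Carathéodory measure of the
largest outer measure assigning at most `∏ᵢ μᵢ(sᵢ)` to every box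
(`MeasureTheory.OuterMeasure.pi`), so `Measure.pi μ (Set.pi univ s) ≤ ∏ᵢ μᵢ(sᵢ)` for measurable
boxes with no hypothesis (`measure_pi_univ_pi_le`, the easy half of
`MeasureTheory.Measure.pi_pi`); expanding a product of simple functions as a finite combination
of indicators of boxes (`prod_simpleFunc_apply_eq_sum`) gives the bound for simple factors
(`lintegral_prod_simpleFunc_pi_le`), and monotone convergence along
`MeasureTheory.SimpleFunc.eapprox` in every factor simultaneously (a finite product of suprema of
monotone sequences in `ℝ≥0∞` is the supremum of the products, `finsetProd_iSup_of_monotone`)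
gives the general case. To apply this to the merely a.e.-measurable `f₀` one replaces
`ENNReal.ofReal ∘ f₀` by an everywhere-larger measurable function with the same integral
(`exists_measurable_ge_lintegral_eq`) and passes between the Bochner and the lower Lebesgue
integral on the product only through `MeasureTheory.integral_eq_lintegral_of_nonneg_ae` (a
non-a.e.-strongly-measurable integrand has Bochner integral `0 ≤ (∫ f₀)^N`):
`integral_le_pow_of_le_prod`. Likewise `𝒵_0 = 1` uses that the empty product measure is a Dirac
mass (`MeasureTheory.volume_pi_eq_dirac`) rather than Fubini. (At a σ-finite position space the
same statements were also obtained, by the Fubini equality, in `BBGKYMarginalsCorrelationProofs.lean`,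
`one_le_gcPartition` and its private helpers.)

## References

* I. Gallagher, L. Saint-Raymond, B. Texier, *From Newton to Boltzmann: hard spheres and
  short-range potentials*, Zurich Lectures in Advanced Mathematics, EMS (2013),
  doi:10.4171/129, arXiv:1208.5753 (held as `lit paper:arxiv-1208.5753`; bib key `GST2013`),
  §6.1.2 (conditioning, canonical partition functions `𝒵_N`, (6.1.4); Lemma 6.1.2).
* T. Bodineau, I. Gallagher, L. Saint-Raymond, S. Simonella, *Long-time correlations for a
  hard-sphere gas at equilibrium*, Comm. Pure Appl. Math. (2023), arXiv:2012.03813 (held as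
  `lit paper:arxiv-2012.03813`; bib key `BGSS2023`), §1.1 (grand-canonical state and partition
  function `𝒵^ε`, (1.5) in the arXiv numbering).
-/

open MeasureTheory Metric Set Filter Topology Function
open scoped InnerProductSpace ENNReal

namespace Literature.Analysis.FluidPDE

noncomputable section

section Kinetic

variable {d : Type*} [Fintype d] {X : Type*}

/-! ## 1. Sub-multiplicativity of `Measure.pi` without σ-finiteness -/

section PiSubmultiplicative

variable {ι : Type*} [Fintype ι] {α : ι → Type*} [∀ i, MeasurableSpace (α i)]

/-- The easy half of `MeasureTheory.Measure.pi_pi`, valid for arbitrary (not necessarily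
σ-finite) factors: the product measure of a measurable box is at most the product of the
measures of its sides, `Measure.pi μ (∏ᵢ sᵢ) ≤ ∏ᵢ μᵢ(sᵢ)`, straight from the definition of
`MeasureTheory.Measure.pi` through `MeasureTheory.OuterMeasure.pi`. [folklore] -/
theorem measure_pi_univ_pi_le (μ : ∀ i, Measure (α i)) {t : ∀ i, Set (α i)}
    (ht : ∀ i, MeasurableSet (t i)) : Measure.pi μ (Set.pi univ t) ≤ ∏ i, μ i (t i) := by
  rw [Measure.pi, toMeasure_apply _ _ (MeasurableSet.univ_pi ht)]
  exact OuterMeasure.pi_pi_le _ _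

/-- In `ℝ≥0∞`, a finite product of suprema of monotone sequences is the supremum of the
products. [folklore] -/
theorem finsetProd_iSup_of_monotone {κ : Type*} (s : Finset κ) {a : κ → ℕ → ℝ≥0∞}
    (ha : ∀ i, Monotone (a i)) : ∏ i ∈ s, ⨆ n, a i n = ⨆ n, ∏ i ∈ s, a i n := by
  classical
  induction s using Finset.induction_on with
  | empty => simp
  | insert j s hj ih =>
    simp_rw [Finset.prod_insert hj]
    rw [ih]
    have hmono : Monotone fun n => ∏ i ∈ s, a i n := fun m n hmn =>
      Finset.prod_le_prod' fun i _ => ha i hmn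
    refine le_antisymm ?_ (iSup_le fun n =>
      mul_le_mul' (le_iSup (fun n => a j n) n) (le_iSup (fun n => ∏ i ∈ s, a i n) n))
    rw [ENNReal.iSup_mul]
    refine iSup_le fun m => ?_
    rw [ENNReal.mul_iSup]
    refine iSup_le fun n => ?_
    exact (mul_le_mul' (ha j (le_max_left m n)) (hmono (le_max_right m n))).trans
      (le_iSup (fun k => a j k * ∏ i ∈ s, a i k) (max m n))

/-- A product of simple functions of the single coordinates is a finite combination of
indicators of measurable boxes: `∏ᵢ φᵢ(zᵢ) = ∑_p (∏ᵢ pᵢ) 1_{∏ᵢ φᵢ⁻¹{pᵢ}}(z)`, the sum over all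
choices `p` of one value `pᵢ` in the range of each `φᵢ`. [folklore] -/
theorem prod_simpleFunc_apply_eq_sum [DecidableEq ι] (φ : ∀ i, SimpleFunc (α i) ℝ≥0∞)
    (z : ∀ i, α i) :
    ∏ i, φ i (z i) =
      ∑ p ∈ Fintype.piFinset fun i => (φ i).range,
        (∏ i, p i) * (Set.pi univ fun i => φ i ⁻¹' {p i}).indicator 1 z := by
  rw [Finset.sum_eq_single_of_mem (fun i => φ i (z i))
      (Fintype.mem_piFinset.2 fun i => (φ i).mem_range_self (z i)) fun p _ hp => ?_]
  · have hz : z ∈ Set.pi univ fun i => φ i ⁻¹' {φ i (z i)} :=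
      Set.mem_univ_pi.2 fun i => Set.mem_preimage.2 (Set.mem_singleton _)
    simp only [indicator_of_mem hz, Pi.one_apply, mul_one]
  · rw [indicator_of_notMem, mul_zero]
    intro hz
    apply hp
    funext i
    have hi : φ i (z i) = p i := by simpa using (Set.mem_univ_pi.1 hz) i
    exact hi.symm

/-- `lintegral_prod_pi_le` for simple factors: `∫⁻ ∏ᵢ φᵢ(zᵢ) ∂(Measure.pi μ) ≤ ∏ᵢ ∫⁻ φᵢ ∂μᵢ`
for simple `φᵢ` and arbitrary measures `μᵢ` (expand in boxes, `prod_simpleFunc_apply_eq_sum`,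
bound each box by `measure_pi_univ_pi_le`, and refactor the sum, `Finset.prod_univ_sum`). [folklore] -/
theorem lintegral_prod_simpleFunc_pi_le (μ : ∀ i, Measure (α i))
    (φ : ∀ i, SimpleFunc (α i) ℝ≥0∞) :
    ∫⁻ z, ∏ i, φ i (z i) ∂Measure.pi μ ≤ ∏ i, (φ i).lintegral (μ i) := by
  classical
  have hA : ∀ p : ι → ℝ≥0∞, MeasurableSet (Set.pi univ fun i => φ i ⁻¹' {p i}) := fun p =>
    MeasurableSet.univ_pi fun i => (φ i).measurableSet_fiber (p i)
  simp_rw [prod_simpleFunc_apply_eq_sum φ]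
  rw [lintegral_finsetSum _ fun p _ => (measurable_one.indicator (hA p)).const_mul _]
  calc ∑ p ∈ Fintype.piFinset (fun i => (φ i).range),
        ∫⁻ z, (∏ i, p i) * (Set.pi univ fun i => φ i ⁻¹' {p i}).indicator 1 z ∂Measure.pi μ
      = ∑ p ∈ Fintype.piFinset (fun i => (φ i).range),
          (∏ i, p i) * Measure.pi μ (Set.pi univ fun i => φ i ⁻¹' {p i}) := by
        refine Finset.sum_congr rfl fun p _ => ?_
        rw [lintegral_const_mul _ (measurable_one.indicator (hA p)), lintegral_indicator_one (hA p)]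
    _ ≤ ∑ p ∈ Fintype.piFinset (fun i => (φ i).range), (∏ i, p i) * ∏ i, μ i (φ i ⁻¹' {p i}) := by
        gcongr with p hp
        exact measure_pi_univ_pi_le μ fun i => (φ i).measurableSet_fiber (p i)
    _ = ∏ i, (φ i).lintegral (μ i) := by
        simp_rw [← Finset.prod_mul_distrib]
        exact (Finset.prod_univ_sum (fun i => (φ i).range) fun i c => c * μ i (φ i ⁻¹' {c})).symm

/-- **Sub-multiplicativity of `Measure.pi` without σ-finiteness** (the easy half of Fubini for
finite products): for measurable `gᵢ : αᵢ → ℝ≥0∞` and *arbitrary* measures `μᵢ`,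
`∫⁻ ∏ᵢ gᵢ(zᵢ) ∂(Measure.pi μ) ≤ ∏ᵢ ∫⁻ gᵢ ∂μᵢ`. (With σ-finite factors this is an equality,
`MeasureTheory.lintegral_fintype_prod_eq_prod`.) Proof: monotone convergence along the simple
approximations `SimpleFunc.eapprox (g i) n` of all factors at once
(`finsetProd_iSup_of_monotone`) reduces to `lintegral_prod_simpleFunc_pi_le`. [folklore] -/
theorem lintegral_prod_pi_le (μ : ∀ i, Measure (α i)) {g : ∀ i, α i → ℝ≥0∞}
    (hg : ∀ i, Measurable (g i)) :
    ∫⁻ z, ∏ i, g i (z i) ∂Measure.pi μ ≤ ∏ i, ∫⁻ x, g i x ∂μ i := by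
  have happrox : ∀ z : ∀ i, α i,
      ∏ i, g i (z i) = ⨆ n, ∏ i, SimpleFunc.eapprox (g i) n (z i) := by
    intro z
    calc ∏ i, g i (z i) = ∏ i, ⨆ n, SimpleFunc.eapprox (g i) n (z i) :=
          Finset.prod_congr rfl fun i _ => (SimpleFunc.iSup_eapprox_apply (hg i) (z i)).symm
      _ = ⨆ n, ∏ i, SimpleFunc.eapprox (g i) n (z i) :=
          finsetProd_iSup_of_monotone (a := fun i n => SimpleFunc.eapprox (g i) n (z i))
            Finset.univ fun i m n hmn => SimpleFunc.monotone_eapprox (g i) hmn (z i)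
  have hmeas : ∀ n, Measurable fun z : ∀ i, α i => ∏ i, SimpleFunc.eapprox (g i) n (z i) :=
    fun n => Finset.measurable_prod _ fun i _ =>
      (SimpleFunc.measurable _).comp (measurable_pi_apply i)
  calc ∫⁻ z, ∏ i, g i (z i) ∂Measure.pi μ
      = ∫⁻ z, ⨆ n, ∏ i, SimpleFunc.eapprox (g i) n (z i) ∂Measure.pi μ :=
        lintegral_congr fun z => happrox z
    _ = ⨆ n, ∫⁻ z, ∏ i, SimpleFunc.eapprox (g i) n (z i) ∂Measure.pi μ :=
        lintegral_iSup hmeas fun m n hmn z =>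
          Finset.prod_le_prod' fun i _ => SimpleFunc.monotone_eapprox (g i) hmn (z i)
    _ ≤ ⨆ n, ∏ i, (SimpleFunc.eapprox (g i) n).lintegral (μ i) :=
        iSup_mono fun n => lintegral_prod_simpleFunc_pi_le μ _
    _ ≤ ∏ i, ∫⁻ x, g i x ∂μ i := iSup_le fun n => Finset.prod_le_prod' fun i _ => ?_
  rw [← SimpleFunc.lintegral_eq_lintegral]
  exact lintegral_mono fun x =>
    (le_iSup (fun n => SimpleFunc.eapprox (g i) n x) n).trans_eq
      (SimpleFunc.iSup_eapprox_apply (hg i) x)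

/-- An a.e.-measurable `f : β → ℝ≥0∞` has an everywhere-larger *measurable* modification with
the same integral: `f ≤ g`, `∫⁻ g = ∫⁻ f` (take `AEMeasurable.mk` and set it to `∞` on a
measurable null set containing the discrepancy set). [folklore] -/
theorem exists_measurable_ge_lintegral_eq {β : Type*} [MeasurableSpace β] (μ : Measure β)
    {f : β → ℝ≥0∞} (hf : AEMeasurable f μ) :
    ∃ g : β → ℝ≥0∞, Measurable g ∧ f ≤ g ∧ ∫⁻ x, g x ∂μ = ∫⁻ x, f x ∂μ := by
  obtain ⟨t, hst, ht, hμt⟩ := exists_measurable_superset_of_null (ae_iff.1 hf.ae_eq_mk)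
  refine ⟨fun x => hf.mk f x + t.indicator (fun _ => ∞) x,
    hf.measurable_mk.add (measurable_const.indicator ht), fun x => ?_, lintegral_congr_ae ?_⟩
  · by_cases hx : x ∈ t
    · simp [hx]
    · have hfx : f x = hf.mk f x := not_not.1 fun h => hx (hst h)
      simp [hx, hfx]
  · filter_upwards [measure_eq_zero_iff_ae_notMem.1 hμt, hf.ae_eq_mk] with x hx hfx
    simp [hx, hfx]

/-- **`∫ F ≤ (∫ f)^N` for `0 ≤ F ≤ f^{⊗N}`, without σ-finiteness.** On `Fin N → Y` with its
product `volume` (`MeasureTheory.MeasureSpace.pi`, for an *arbitrary* `[MeasureSpace Y]`), a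
function `F` with `0 ≤ F(z) ≤ ∏ᵢ f(zᵢ)`, `f ≥ 0` integrable, has Bochner integral at most
`(∫ f)^N` — the junk value `0` of a non-integrable `F` included. (`lintegral_prod_pi_le` applied
to a measurable majorant of `ENNReal.ofReal ∘ f` with the same integral,
`exists_measurable_ge_lintegral_eq`, and `MeasureTheory.ofReal_integral_eq_lintegral_ofReal`.) [folklore] -/
theorem integral_le_pow_of_le_prod {Y : Type*} [MeasureSpace Y] {N : ℕ} {f : Y → ℝ}
    (hf : 0 ≤ f) (hfi : Integrable f) {F : (Fin N → Y) → ℝ} (hF0 : 0 ≤ F)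
    (hFle : ∀ z, F z ≤ ∏ i, f (z i)) : ∫ z, F z ≤ (∫ y, f y) ^ N := by
  have hI : 0 ≤ ∫ y, f y := integral_nonneg hf
  obtain ⟨g, hgm, hfg, hgint⟩ :=
    exists_measurable_ge_lintegral_eq volume hfi.aemeasurable.ennreal_ofReal
  have hkey : ∫⁻ z, ENNReal.ofReal (F z) ≤ ENNReal.ofReal ((∫ y, f y) ^ N) := by
    calc ∫⁻ z, ENNReal.ofReal (F z)
        ≤ ∫⁻ z : Fin N → Y, ∏ i, g (z i) := lintegral_mono fun z => ?_
      _ ≤ ∏ _i : Fin N, ∫⁻ y, g y := lintegral_prod_pi_le (fun _ => volume) fun _ => hgm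
      _ = ENNReal.ofReal ((∫ y, f y) ^ N) := by
          rw [Finset.prod_const, Finset.card_univ, Fintype.card_fin, hgint,
            ← ofReal_integral_eq_lintegral_ofReal hfi (Eventually.of_forall hf),
            ENNReal.ofReal_pow hI]
    calc ENNReal.ofReal (F z) ≤ ENNReal.ofReal (∏ i, f (z i)) := ENNReal.ofReal_le_ofReal (hFle z)
      _ = ∏ i, ENNReal.ofReal (f (z i)) := ENNReal.ofReal_prod_of_nonneg fun i _ => hf (z i)
      _ ≤ ∏ i, g (z i) := Finset.prod_le_prod' fun i _ => hfg (z i)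
  by_cases hFm : AEStronglyMeasurable F volume
  · rw [integral_eq_lintegral_of_nonneg_ae (Eventually.of_forall hF0) hFm]
    exact ENNReal.toReal_le_of_le_ofReal (pow_nonneg hI N) hkey
  · rw [integral_non_aestronglyMeasurable hFm]
    exact pow_nonneg hI N

end PiSubmultiplicative

/-! ## 2. The canonical and grand-canonical partition functions -/

section GrandCanonicalPos

open scoped Nat

variable [MeasureSpace X]

/-- The canonical partition function is dominated by the free one, `𝒵_N ≤ (∫ f₀)^N`, for
`0 ≤ f₀ ∈ L¹` and an *arbitrary* `[MeasureSpace X]`: pointwise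
`0 ≤ 1_{D_ε^N} f₀^{⊗N} ≤ f₀^{⊗N}`, and `integral_le_pow_of_le_prod` (the hypothesis-free half
of Fubini for `Measure.pi`, `lintegral_prod_pi_le`) bounds the integral of any such function on
`Config N d X = (X × ℝ^d)^N` by `(∫ f₀)^N`; no σ-finiteness of `volume` on `X` and no
measurability of `D_ε^N` are needed (with σ-finiteness one could instead quote the Fubini
*equality* `MeasureTheory.integral_fintype_prod_volume_eq_pow` for the majorant). This is the
termwise comparison `1_{D_ε^N} ≤ 1` behind `gcPartition_le_exp`. [folklore] -/
theorem canonicalPartition_le_pow_integral (G : Geometry d X) (ε : ℝ) (N : ℕ)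
    {f₀ : X × EuclideanSpace ℝ d → ℝ} (hf₀ : 0 ≤ f₀) (hf₀' : Integrable f₀) :
    canonicalPartition G ε N f₀ ≤ (∫ z, f₀ z) ^ N :=
  integral_le_pow_of_le_prod hf₀ hf₀'
    (fun z => indicator_nonneg (fun w _ => tensorPow_nonneg hf₀ N w) z)
    fun z => indicator_le_self' (fun w _ => tensorPow_nonneg hf₀ N w) z

/-- Without particles the canonical partition function is `1`: `D_ε^0` is all of
`Config 0 d X`, `f₀^{⊗0} = 1`, and `Config 0 d X` is a one-point probability space (the empty
product measure is a Dirac mass, `MeasureTheory.volume_pi_eq_dirac` — no σ-finiteness needed),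
so `𝒵_0 = ∫ 1 = 1`. (The same computation for the torus geometry and Maxwellian data is
`Literature.MathematicalPhysics.KineticTheory.canonicalPartition_zero` of
`TaggedSphereLinearBoltzmann.lean`; the present name avoids shadowing it.) [folklore] -/
theorem canonicalPartition_zero_eq_one (G : Geometry d X) (ε : ℝ)
    (f₀ : X × EuclideanSpace ℝ d → ℝ) : canonicalPartition G ε 0 f₀ = 1 := by
  have hD : hardSphereDomain G 0 ε = (univ : Set (Config 0 d X)) :=
    eq_univ_of_forall fun z => mem_hardSphereDomain.2 fun i => i.elim0
  have hP : IsProbabilityMeasure (volume : Measure (Config 0 d X)) := by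
    rw [Measure.volume_pi_eq_dirac]
    infer_instance
  unfold canonicalPartition
  rw [hD, indicator_univ]
  simp [tensorPow]

/-- Termwise domination of the grand-canonical series by the exponential series:
`(μ^N / N!) 𝒵_N ≤ (μ ∫ f₀)^N / N!` for `0 ≤ μ`, `0 ≤ f₀ ∈ L¹`
(`canonicalPartition_le_pow_integral`). [folklore] -/
theorem gcPartition_term_le (G : Geometry d X) (ε : ℝ) {μ : ℝ} (hμ : 0 ≤ μ)
    {f₀ : X × EuclideanSpace ℝ d → ℝ} (hf₀ : 0 ≤ f₀) (hf₀' : Integrable f₀) (N : ℕ) :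
    μ ^ N / (N ! : ℝ) * canonicalPartition G ε N f₀ ≤ (μ * ∫ z, f₀ z) ^ N / (N ! : ℝ) := by
  rw [mul_pow, mul_div_right_comm]
  exact mul_le_mul_of_nonneg_left (canonicalPartition_le_pow_integral G ε N hf₀ hf₀')
    (div_nonneg (pow_nonneg hμ N) (Nat.cast_nonneg _))

/-- The grand-canonical series `∑_N (μ^N / N!) 𝒵_N` defining `gcPartition G ε μ f₀` is summable
for `0 ≤ μ`, `0 ≤ f₀ ∈ L¹`: its terms are nonnegative (`canonicalPartition_nonneg`) and dominated
by those of the exponential series `∑_N (μ ∫ f₀)^N / N!` (`gcPartition_term_le`,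
`Real.summable_pow_div_factorial`). In particular `gcPartition G ε μ f₀` is a genuine sum, not
the junk value `0` of `tsum`. [folklore] -/
theorem summable_gcPartition_term (G : Geometry d X) (ε : ℝ) {μ : ℝ} (hμ : 0 ≤ μ)
    {f₀ : X × EuclideanSpace ℝ d → ℝ} (hf₀ : 0 ≤ f₀) (hf₀' : Integrable f₀) :
    Summable fun N => μ ^ N / (N ! : ℝ) * canonicalPartition G ε N f₀ :=
  (Real.summable_pow_div_factorial (μ * ∫ z, f₀ z)).of_nonneg_of_le
    (fun N => mul_nonneg (div_nonneg (pow_nonneg hμ N) (Nat.cast_nonneg _))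
      (canonicalPartition_nonneg G ε N hf₀))
    (gcPartition_term_le G ε hμ hf₀ hf₀')

/-- **`gcPartition_pos` holds** (discharge of the named fact
`Literature.Analysis.FluidPDE.gcPartition_pos`, with exactly its parameters — an arbitrary
`[MeasureSpace X]`): the grand-canonical partition function
`𝒵^ε = ∑_N (μ^N / N!) ∫ 1_{D_ε^N} f₀^{⊗N} dZ_N` of the Gibbs-type hard-sphere state (GST 2013
§6.1, canonical partition functions `𝒵_N`; BGSS 2023 §1.1 (1.1.5), grand-canonical `𝒵^ε`) is
positive for `0 ≤ μ` and `0 ≤ f₀ ∈ L¹`. Proof as announced in the fact's docstring: every term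
is nonnegative (`canonicalPartition_nonneg`), the `N = 0` term is `𝒵_0 = 1`
(`canonicalPartition_zero_eq_one`), and the series is summable, being dominated termwise by
`∑_N (μ ∫ f₀)^N / N! = exp (μ ∫ f₀)` (`summable_gcPartition_term`), so the `tsum` is a genuine
sum, at least its `N = 0` term (`Summable.tsum_pos`). [cite: GST2013, §6.1] -/
theorem gcPartition_pos_holds : gcPartition_pos (d := d) (X := X) := by
  intro G ε μ hμ f₀ hf₀ hf₀'
  refine (summable_gcPartition_term G ε hμ hf₀ hf₀').tsum_pos
    (fun N => mul_nonneg (div_nonneg (pow_nonneg hμ N) (Nat.cast_nonneg _))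
      (canonicalPartition_nonneg G ε N hf₀)) 0 ?_
  simp [canonicalPartition_zero_eq_one]

/-- **`gcPartition_le_exp` holds** (discharge of the named fact
`Literature.Analysis.FluidPDE.gcPartition_le_exp`, with exactly its parameters — an arbitrary
`[MeasureSpace X]`, no σ-finiteness): the grand-canonical partition function is dominated by the
free one, `𝒵^ε ≤ ∑_N (μ ∫ f₀)^N / N! = exp (μ ∫ f₀)`, for `0 ≤ μ`, `0 ≤ f₀ ∈ L¹`: termwise
comparison `1_{D_ε^N} ≤ 1` (`gcPartition_term_le`, `summable_gcPartition_term`,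
`Summable.tsum_le_tsum`) and the exponential series `Real.exp x = ∑_N x^N / N!`
(`Real.exp_eq_exp_ℝ`, `NormedSpace.exp_eq_tsum_div`); an elementary consequence of the
definitions GST 2013 §6.1.2 (6.1.4) (`𝒵_N`) and BGSS 2023 §1.1 (1.1.5) (`𝒵^ε`), where
`∫ f₀ = 1`. [cite: GST2013, §6.1] -/
theorem gcPartition_le_exp_holds : gcPartition_le_exp (d := d) (X := X) := by
  intro G ε μ hμ f₀ hf₀ hf₀'
  calc gcPartition G ε μ f₀ ≤ ∑' N : ℕ, (μ * ∫ z, f₀ z) ^ N / (N ! : ℝ) :=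
        (summable_gcPartition_term G ε hμ hf₀ hf₀').tsum_le_tsum
          (gcPartition_term_le G ε hμ hf₀ hf₀') (Real.summable_pow_div_factorial _)
    _ = Real.exp (μ * ∫ z, f₀ z) := by
        rw [Real.exp_eq_exp_ℝ, NormedSpace.exp_eq_tsum_div]

end GrandCanonicalPos

end Kinetic

end

end Literature.Analysis.FluidPDE
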